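import Literature.AlgebraicGeometry.AbelianSchemes.AbelianSchemeTheoremOfSquareOfDualPair
import Literature.AlgebraicGeometry.AbelianSchemes.AbelianSchemeOverHomNoetherianAnyBase
import Literature.AlgebraicGeometry.AbelianSchemes.PoincareSheafBiadditiveAnyBase
import HarnessLib

/-!
# `Λ(L) : A → Â` is a homomorphism classifying the Mumford family, with kernel `K(L)` — ANY locally Noetherian base
# ([MumfordFogartyKirwan1994] Ch. 6 §2 Def. 6.2, «`Λ(L)` is a homomorphism»; any-base edition of ★ `exists_isMonHom_classify_mumfordBundle`)

Layer `Literature/AlgebraicGeometry/AbelianSchemes`, namespace `Literature.AlgebraicGeometry.AbelianSchemes.AbelianSchemeOver`.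
THEOREMS ONLY (no definition, no named fact, no instance, no notation, no `sorry`).  Cell `hodgecm-mathlib` (D-0151), F-DAG row
F-2 (e) / F-6 (V), any-base edition α-2 (B-p08 (g12); census B-p17 (g12) `CENSUS-F6V-LDeltaCubeLocus` §3 road (α)): the ★ brick
`AbelianSchemeTheoremOfSquareOfDualPair.exists_isMonHom_classify_mumfordBundle` (B-p07 (g15)) produces `λ_L = Λ(L)` over a
CONNECTED locally Noetherian base — connectedness enters ONLY through [MumfordFogartyKirwan1994] Cor. 6.4 in its connected form (★
`isMonHom_of_one_comp_of_isLocallyNoetherian`).  Cor. 6.4 over ANY locally Noetherian base is ★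
(`AbelianSchemeOverHomNoetherianAnyBase.isMonHom_of_one_comp_of_isLocallyNoetherian_base`, all residue points + Stein), so the
printed construction runs verbatim over any locally Noetherian `S` — the generality [MumfordFogartyKirwan1994] Prop. 7.3 step (V)
needs (`H₄` is not connected).  Hypothesis/conclusion (ii) is given in the `Over S` whisker spelling `(A ◁ (u ≫ λ_L))^*𝒫 ≅ (A ◁ u)^*Λ(L)`
(Mathlib-native; ★ `DualPair.pullbackP_eq_pullback_whiskerLeft` bridges to `D.pullbackP`), the shape consumed by ★
`AbelianSchemeLDeltaLocusClosedAnyBase`.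

SETTING.  `A/S` an abelian scheme over a locally Noetherian `S`, `L` a rank-one module on `A` rigidified along the zero section
(`ε^*[L] = 1`), `Λ(L)` its Mumford bundle on `A ×_S A` (★ `mumfordBundle`), `D = (Â, 𝒫)` a dual pair with the unit hypothesis
`hD : 𝒫|_{A × {ε_Â}} ≅ 𝒪`.

* §1 **`exists_isMonHom_classify_mumfordBundle_of_isLocallyNoetherian_base`** — there is an `S`-HOMOMORPHISM `λ_L : A → Â` with
  (ii) `(A ◁ (u ≫ λ_L))^*𝒫 ≅ (A ◁ u)^*Λ(L)` for every `S`-scheme `T` and `u : T → A` (it classifies the Mumford family) and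
  (iii) `u ∈ K(L)(T) ↔ u ≫ λ_L = 1` (★ `MemKOfL`, [MumfordAV1970] §13).  Body = ★ p758163 §4 verbatim (the universal family
  `(1_A × 1_A)^*Λ(L)` on `A_A`, ★ `DualPair.classify`, naturality ★ `DualPair.baseChangeToProd_comp`, rigidity at `ε`), with
  Cor. 6.4 swapped for its any-base edition.
* §2 **`left_eq_left_of_classify_mumfordBundle`** / **`eq_of_classify_mumfordBundle`** — ANY two `S`-morphisms `A → Â` with (ii)
  are EQUAL (any base `S`: (ii) at `u = 𝟙_A` says both classify the rigidified fibrewise-`Pic⁰` family `Λ(L)` on `A_A`; ★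
  `DualPair.eq_of_nonempty_iso`) — so `Λ(L)` is a NAME, and every consumer hypothesis «`lam` with (ii)» is discharged by §1 uniquely.

HC_CM is proved only modulo the 7 printed citations until rung 0 closes; nothing here is about HC.

## References
* [MumfordFogartyKirwan1994] D. Mumford, J. Fogarty, F. Kirwan, *Geometric Invariant Theory*, 3rd ed. (1994), Ch. 6 §1
  Cor. 6.4 (p. 117), §2 Definition 6.2 (p. 120); Ch. 7 §3 Prop. 7.3 (pp. 133–134).
* [MumfordAV1970] D. Mumford, *Abelian Varieties* (1970), §8 (pp. 74–75), §13 (pp. 123–125).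
* [MilneAV2008] J. S. Milne, *Abelian Varieties* (v2.00, 2008), I §8 pp. 36–37.
-/

set_option backward.isDefEq.respectTransparency false

noncomputable section

open CategoryTheory CategoryTheory.Limits AlgebraicGeometry MonoidalCategory CartesianMonoidalCategory
open scoped MonObj

universe u

namespace Literature.AlgebraicGeometry.AbelianSchemes

open Literature.AlgebraicGeometry.Motives Literature.AlgebraicGeometry.Modules
  Literature.AlgebraicGeometry.AbelianVarieties

namespace AbelianSchemeOver

variable {S : Scheme.{u}} (A : AbelianSchemeOver S) {L : A.left.Modules} (D : A.DualPair)
  (hL : HasRank L 1) (hε : CechPic.pullback A.unitSection (detClass (HasRank.isFiniteLocallyFree' hL)) = 1)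

/-! ## §0 The Mumford family `Λ(L)|_u` as a rigidified fibrewise-`Pic⁰` line bundle (any base) -/

include hε in
/-- For every `S`-morphism `u : T → A`, the restriction `(A ◁ u)^*Λ(L)` of the Mumford bundle to `A ×_S T` underlies a rigidified
line bundle on `A_T` lying fibrewise in `Pic⁰` (★ `hasRank_mumfordFamily`, ★ `rigid_mumfordFamily`, ★ `fibrewisePicZero_mumfordFamily`,
★ `baseChangeToProd_eq_whiskerLeft_left`) — a test object of the universal property of `(Â, 𝒫)`.
[cite: MumfordFogartyKirwan1994, Ch. 6 §2 Definition 6.2 (p. 120)] [cite: MumfordAV1970, §8 (pp. 74–75)] -/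
theorem exists_rigidifiedLineBundle_mumfordFamily_whiskerLeft {T : Over S} (u : T ⟶ A.X) :
    ∃ ℒ : A.RigidifiedLineBundle T.hom,
      ℒ.L = (Scheme.Modules.pullback (A.X ◁ u).left).obj (A.mumfordBundle L) ∧ ℒ.FibrewisePicZero := by
  refine ⟨⟨(Scheme.Modules.pullback (A.baseChangeToProd A T.hom u.left (Over.w u))).obj (A.mumfordBundle L),
    A.hasRank_mumfordFamily hL _ _ _, A.rigid_mumfordFamily hL hε _ _ _⟩, ?_, A.fibrewisePicZero_mumfordFamily hL hε _ _ _⟩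
  exact congrArg (fun x => (Scheme.Modules.pullback x).obj (A.mumfordBundle L)) (A.baseChangeToProd_eq_whiskerLeft_left A u)

/-! ## §1 `Λ(L)` over ANY locally Noetherian base -/

section Classify

variable [IsLocallyNoetherian S]
  (hD : Nonempty ((Scheme.Modules.pullback (DualPair.unitHatSlice D)).obj D.P ≅ SheafOfModules.unit _))

include hD hε in
/-- **`Λ(L) : A → Â` IS A HOMOMORPHISM classifying the Mumford family, with kernel `K(L)` — ANY locally Noetherian base**
([MumfordFogartyKirwan1994] Ch. 6 §2 Def. 6.2 «`Λ(L)`», p. 120 «`Λ(L)` is a homomorphism»; [MumfordAV1970] §8 Thm. 1 / §13): for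
a dual pair `D = (Â, 𝒫)` with `𝒫|_{A × {ε_Â}} ≅ 𝒪` and a rigidified rank-one `L`, there is an `S`-morphism `λ_L : A → Â` such that
(i) `λ_L` is a homomorphism of abelian schemes; (ii) `(A ◁ (u ≫ λ_L))^*𝒫 ≅ (A ◁ u)^*Λ(L)` for every `S`-scheme `T` and every
`u : T → A` (it CLASSIFIES the Mumford family; whisker spelling); (iii) `u ∈ K(L)(T) ↔ u ≫ λ_L = 1`.  Proof = ★
`exists_isMonHom_classify_mumfordBundle` verbatim (★ `DualPair.classify` of the universal family `(1_A × 1_A)^*Λ(L)` on `A_A`,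
naturality ★ `DualPair.baseChangeToProd_comp`, uniqueness against the value at `ε`), except that (i) — `λ_L ∘ ε_A = ε_Â` because
both classify the trivial family — now invokes Cor. 6.4 over ANY locally Noetherian base (★
`isMonHom_of_one_comp_of_isLocallyNoetherian_base`: all residue points + Stein; no connectedness, no reducedness).
[cite: MumfordFogartyKirwan1994, Ch. 6 §2 Definition 6.2 (p. 120) and §1 Corollary 6.4 (p. 117)]
[cite: MumfordAV1970, §8 (pp. 74–75) and §13 (pp. 123–125)] [cite: MilneAV2008, I §8 pp. 36–37] -/
theorem exists_isMonHom_classify_mumfordBundle_of_isLocallyNoetherian_base :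
    ∃ lam : A.X ⟶ D.hat.X, IsMonHom lam ∧
      (∀ ⦃T : Over S⦄ (u : T ⟶ A.X),
        Nonempty ((Scheme.Modules.pullback (A.X ◁ (u ≫ lam)).left).obj D.P ≅
          (Scheme.Modules.pullback (A.X ◁ u).left).obj (A.mumfordBundle L))) ∧
      ∀ ⦃T : Over S⦄ (u : T ⟶ A.X), A.MemKOfL L u ↔ u ≫ lam = 1 := by
  -- the universal Mumford family `𝒬 = (1_A × 1_A)^*Λ(L)` on `A_A` (base `A`), rigidified and fibrewise in `Pic⁰`
  let 𝒬 : A.RigidifiedLineBundle A.X.hom :=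
    ⟨(Scheme.Modules.pullback (A.baseChangeToProd A A.X.hom (𝟙 _) (Category.id_comp _))).obj (A.mumfordBundle L),
      A.hasRank_mumfordFamily hL _ _ _, A.rigid_mumfordFamily hL hε _ _ _⟩
  have h₀ : 𝒬.FibrewisePicZero := A.fibrewisePicZero_mumfordFamily hL hε _ _ _
  -- its classifying morphism
  let lam' : A.X.left ⟶ D.hat.X.left := D.classify A.X.hom 𝒬 h₀
  have hlam' : lam' ≫ D.hat.X.hom = A.X.hom := D.classify_comp_hom _ _ _
  let lam : A.X ⟶ D.hat.X := Over.homMk lam' hlam'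
  -- (ii) the restriction formula, `pullbackP` spelling
  have hres : ∀ {T : Over S} (u : T ⟶ A.X),
      Nonempty (D.pullbackP T.hom (u ≫ lam).left (Over.w _) ≅
        (Scheme.Modules.pullback (A.X ◁ u).left).obj (A.mumfordBundle L)) := by
    intro T u
    obtain ⟨i⟩ := D.nonempty_pullbackP_classify_iso A.X.hom 𝒬 h₀
    obtain ⟨j⟩ := A.nonempty_pullback_baseChangeToProd_universalMumford_iso (L := L) u
    have hc : A.baseChangeToProd D.hat T.hom (u ≫ lam).left (Over.w _) =
        A.baseChangeToProd A T.hom u.left (Over.w u) ≫ A.baseChangeToProd D.hat A.X.hom lam' hlam' :=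
      DualPair.baseChangeToProd_comp (A := A) T.hom u.left lam' (Over.w u) hlam'
    exact ⟨(Scheme.Modules.pullbackCongr hc).app D.P ≪≫ ((Scheme.Modules.pullbackComp _ _).app D.P).symm ≪≫
      (Scheme.Modules.pullback (A.baseChangeToProd A T.hom u.left (Over.w u))).mapIso i ≪≫ j⟩
  have hunit : ∀ (T : Over S), Nonempty (D.pullbackP T.hom (T.hom ≫ D.hat.unitSection)
      (by rw [Category.assoc, D.hat.unitSection_comp_hom, Category.comp_id]) ≅ SheafOfModules.unit _) := fun T =>
    D.nonempty_pullbackP_comp_unitSection_iso T.hom hD _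
  -- (iii) for ANY `u`: `Λ(L)|_u ≅ 𝒪 ↔ u ≫ λ = 1`
  have hker : ∀ {T : Over S} (u : T ⟶ A.X), A.MemKOfL L u ↔ u ≫ lam = 1 := by
    intro T u
    have h1 : (1 : T ⟶ D.hat.X).left = T.hom ≫ D.hat.unitSection := by
      rw [Hom.one_def, Over.comp_left, Over.toUnit_left]
    constructor
    · rintro ⟨e⟩
      obtain ⟨ℒ, hℒL, hℒ⟩ := A.exists_rigidifiedLineBundle_mumfordFamily_whiskerLeft hL hε u
      obtain ⟨i⟩ := hres u
      obtain ⟨k⟩ := hunit T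
      have key := D.eq_of_nonempty_iso T.hom ℒ hℒ (u ≫ lam).left (T.hom ≫ D.hat.unitSection) (Over.w _)
        (by rw [Category.assoc, D.hat.unitSection_comp_hom, Category.comp_id])
        ⟨i ≪≫ eqToIso hℒL.symm⟩ ⟨k ≪≫ e.symm ≪≫ eqToIso hℒL.symm⟩
      ext
      rw [key, h1]
    · intro h
      obtain ⟨i⟩ := hres u
      obtain ⟨k⟩ := hunit T
      have h' : (u ≫ lam).left = T.hom ≫ D.hat.unitSection := by rw [h, h1]
      exact ⟨i.symm ≪≫ eqToIso (D.pullbackP_congr T.hom h' (Over.w _) _) ≪≫ k⟩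
  -- (i) `λ` kills the unit: `ε_A ∈ K(L)(S)` (★ `kOfL`, `one_mem`), so `η ≫ λ = 1 = η`; Cor. 6.4 over ANY locally Noetherian base
  have hone : η[A.X] ≫ lam = η[D.hat.X] := by
    have h1 : (η[A.X] : 𝟙_ (Over S) ⟶ A.X) = 1 := by
      rw [Hom.one_def, toUnit_unique (toUnit _) (𝟙 _), Category.id_comp]
    have hmem : A.MemKOfL L (η[A.X] : 𝟙_ (Over S) ⟶ A.X) := by
      rw [h1]; exact (A.mem_kOfL_iff hL hε _).1 (A.kOfL L hL hε (𝟙_ (Over S))).one_mem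
    rw [(hker _).1 hmem, Hom.one_def, toUnit_unique (toUnit _) (𝟙 _), Category.id_comp]
  haveI : IsMonHom lam := isMonHom_of_one_comp_of_isLocallyNoetherian_base (A := A) (B := D.hat) lam hone
  refine ⟨lam, inferInstance, fun T u => ?_, fun T u => hker u⟩
  rw [← D.pullbackP_eq_pullback_whiskerLeft]
  exact hres u

end Classify

/-! ## §2 Uniqueness: `Λ(L)` is well defined (any base) -/

include hε in
/-- **Two `S`-morphisms `A → Â` classifying the Mumford family of `L` have the same underlying scheme morphism** (any base `S`):
hypothesis (ii) at `u = 𝟙_A` says that both `λ.left, λ'.left : A → Â` (over `π : A → S`) classify the rigidified fibrewise-`Pic⁰`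
family `(A ◁ 𝟙_A)^*Λ(L)` on `A_A` (§0), so they agree by the uniqueness clause of the universal property of `(Â, 𝒫)` (★
`DualPair.eq_of_nonempty_iso`; ★ `DualPair.pullbackP_eq_pullback_whiskerLeft`). [cite: MilneAV2008, I §8 pp. 36–37]
[cite: MumfordFogartyKirwan1994, Ch. 6 §2 Definition 6.2 (p. 120)] -/
theorem left_eq_left_of_classify_mumfordBundle (lam lam' : A.X ⟶ D.hat.X)
    (hlam : ∀ ⦃T : Over S⦄ (u : T ⟶ A.X),
      Nonempty ((Scheme.Modules.pullback (A.X ◁ (u ≫ lam)).left).obj D.P ≅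
        (Scheme.Modules.pullback (A.X ◁ u).left).obj (A.mumfordBundle L)))
    (hlam' : ∀ ⦃T : Over S⦄ (u : T ⟶ A.X),
      Nonempty ((Scheme.Modules.pullback (A.X ◁ (u ≫ lam')).left).obj D.P ≅
        (Scheme.Modules.pullback (A.X ◁ u).left).obj (A.mumfordBundle L))) :
    lam.left = lam'.left := by
  obtain ⟨ℒ, hℒL, hℒ⟩ := A.exists_rigidifiedLineBundle_mumfordFamily_whiskerLeft hL hε (𝟙 A.X)
  obtain ⟨i⟩ := hlam (𝟙 A.X)
  obtain ⟨i'⟩ := hlam' (𝟙 A.X)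
  have key := D.eq_of_nonempty_iso A.X.hom ℒ hℒ (𝟙 A.X ≫ lam).left (𝟙 A.X ≫ lam').left (Over.w _) (Over.w _)
    ⟨eqToIso (D.pullbackP_eq_pullback_whiskerLeft (𝟙 A.X ≫ lam)) ≪≫ i ≪≫ eqToIso hℒL.symm⟩
    ⟨eqToIso (D.pullbackP_eq_pullback_whiskerLeft (𝟙 A.X ≫ lam')) ≪≫ i' ≪≫ eqToIso hℒL.symm⟩
  simpa using key

include hε in
/-- **`Λ(L)` is unique**: two `S`-morphisms `A → Â` with the classifying property (ii) are EQUAL — so the homomorphism of §1 is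
THE `Λ(L)` of [MumfordFogartyKirwan1994] Def. 6.2, and any consumer hypothesis «`lam` with (ii)» names it. [cite: MilneAV2008, I §8 pp. 36–37]
[cite: MumfordFogartyKirwan1994, Ch. 6 §2 Definition 6.2 (p. 120)] -/
theorem eq_of_classify_mumfordBundle (lam lam' : A.X ⟶ D.hat.X)
    (hlam : ∀ ⦃T : Over S⦄ (u : T ⟶ A.X),
      Nonempty ((Scheme.Modules.pullback (A.X ◁ (u ≫ lam)).left).obj D.P ≅
        (Scheme.Modules.pullback (A.X ◁ u).left).obj (A.mumfordBundle L)))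
    (hlam' : ∀ ⦃T : Over S⦄ (u : T ⟶ A.X),
      Nonempty ((Scheme.Modules.pullback (A.X ◁ (u ≫ lam')).left).obj D.P ≅
        (Scheme.Modules.pullback (A.X ◁ u).left).obj (A.mumfordBundle L))) :
    lam = lam' :=
  Over.OverMorphism.ext (A.left_eq_left_of_classify_mumfordBundle D hL hε lam lam' hlam hlam')

end AbelianSchemeOver

end Literature.AlgebraicGeometry.AbelianSchemes

end
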